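import Summits.AtomisticToContinuum.FouriersLaw.Theses.BondHeatUncertainty
import Literature.MathematicalPhysics.KineticTheory.LangevinChainReversal
import Literature.Probability.Entropy.FluctuationTheoremUncertainty
import Summits.AtomisticToContinuum.FouriersLaw.Theorems.BondHeatUncertaintyDefs
import Summits.AtomisticToContinuum.FouriersLaw.Theorems.BondHeatUncertaintyLinearResponseFTURNessFacts
import Summits.AtomisticToContinuum.FouriersLaw.Theorems.BondHeatUncertaintyLinearResponseFTUREntropyBalanceHelper1
import Summits.AtomisticToContinuum.FouriersLaw.Theorems.BondHeatUncertaintyLinearResponseFTUREntropyBalanceHelper2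
import Summits.AtomisticToContinuum.FouriersLaw.Theorems.BondHeatUncertaintyLinearResponseFTUREntropyBalanceHelper4

/-!
# Entropy balance (K4) of line `lebesgue-flip-duality` (crux ★ `LinearResponseFTUR`, stmt-AtomisticToContinuum-9122)

Stub `stub_entropyBalance` of the line: the stationary entropy balance of the thermostatted pinned chain in
Lebowitz–Spohn form, DERIVED from the heat-flux detailed balance (GDB)
`Θ̃_* R = exp(Q_L/T_L + Q_R/T_R) · R` of the chain started from Lebesgue measure (the hypothesis; it is
produced by the neighbouring stubs K1 + K3 of the line). Under weak-NESS uniqueness, for every weak steady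
state `μ` (`N ≥ 2`, `T_L, T_R > 0`) with `KL(μ ‖ Θ_*μ) < ∞` and every `t > 0`, the endpoint–heat law
`P = fluxLaw … μ` of the stationary process on `[0, t]` satisfies: `P` is a probability measure,
`P ≪ Θ̃_*P ≪ P`, `log(dP/dΘ̃_*P) ∈ L¹(P)`, both bath heats are in `L¹(P)`, and
`∫ log(dP/dΘ̃_*P) dP = KL(μ ‖ Θ_*μ) - E[Q_L]/T_L - E[Q_R]/T_R`.

Proof (assembled here from the four helper files `…EntropyBalanceHelper1–4` and the lead's
`…LinearResponseFTURNessFacts`): (U) makes `μ` the kernel-invariant Krylov–Bogoliubov state with a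
Lebesgue density `ρ` and an exponential moment; `P = ρ(x_0) · R_obs` with `R_obs = fluxLaw Leb` σ-finite,
and (GDB) is the flip duality `Θ̃_* R_obs = e^W R_obs`, `W = Q_L/T_L + Q_R/T_R`; the abstract
`flip_duality` gives `P ≪ Θ̃_*P ≪ P` (from `μ ≪ Θ_*μ`, i.e. `ρ∘Θ ≠ 0` `μ`-a.e., transported to `x_t`
by the one-time law) and `llr = log ρ(x_0) - log ρ(Θx_t) - W = llr(μ,Θ_*μ)(x_0) + [f(x_0) - f(x_t)] - W`
with `f = log ρ∘Θ`; the first term has mean `KL(μ‖Θ_*μ)`, `W ∈ L¹` (heats), and the coboundary has mean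
`0` by `coboundary_integral_eq_zero` (truncation + Fatou + dominated convergence; lower bound
`llr ≥ -e^{-llr}` with `e^{-llr} = dΘ̃_*P/dP ∈ L¹(P)`), with NO finite-entropy hypothesis on `ρ`.
-/

noncomputable section



namespace Summit.AtomisticToContinuum.FouriersLaw.Theorems.LinearResponseFTUR

open MeasureTheory ProbabilityTheory Filter Topology Set
open scoped NNReal ENNReal
open Literature.MathematicalPhysics.KineticTheory
open Literature.MathematicalPhysics.KineticTheory.HeatConduction
open Literature.Probability.Process
open Summit.AtomisticToContinuum.FouriersLaw.Theorems.BondHeatUncertainty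
open Summit.AtomisticToContinuum.FouriersLaw.Theorems.SubdiffusiveBondHeat

section Law

variable {ω₂ lam β γ : ℝ} (hω : 0 < ω₂) (hl : 0 ≤ lam) (hβ : 0 ≤ β) (hγ : 0 ≤ γ) (N : ℕ) (T_L T_R : ℝ)
include hω hl hβ hγ

/-- `fluxLaw μ` is a probability measure for a probability measure `μ`. [folklore] -/
theorem isProbabilityMeasure_fluxLaw (μ : Measure (PhaseSpace N)) [IsProbabilityMeasure μ]
    (i0 iN ib : Fin N) (t : ℝ) :
    IsProbabilityMeasure (fluxLaw (pinnedChain ω₂ lam β γ) N i0 iN ib T_L T_R t μ) :=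
  Measure.isProbabilityMeasure_map (EquilibriumBondHeatVariance.measurable_rawObs_fwdPath hω hl hβ hγ N T_L T_R i0 iN ib t).aemeasurable

/-- **The density enters through `x_0`**: `fluxLaw (ρ · Leb) = ρ(x_0) · fluxLaw Leb` for every measurable
`ρ`. [folklore] -/
theorem fluxLaw_withDensity {ρ : PhaseSpace N → ℝ≥0∞} (hρ : Measurable ρ) (i0 iN ib : Fin N) (t : ℝ) :
    fluxLaw (pinnedChain ω₂ lam β γ) N i0 iN ib T_L T_R t ((volume : Measure (PhaseSpace N)).withDensity ρ) =
      (fluxLaw (pinnedChain ω₂ lam β γ) N i0 iN ib T_L T_R t volume).withDensity (fun y => ρ y.1) := by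
  have hobs := EquilibriumBondHeatVariance.measurable_rawObs_fwdPath hω hl hβ hγ N T_L T_R i0 iN ib t
  rw [fluxLaw_eq, fluxLaw_eq, prod_withDensity_left hρ]
  refine Measure.ext_of_lintegral _ fun G hG => ?_
  have hρ1 : Measurable fun z : PhaseSpace N × WienerPair => ρ z.1 := hρ.comp measurable_fst
  have hρ2 : Measurable fun y : Obs N => ρ y.1 := hρ.comp measurable_fst
  have hGo : Measurable fun a : PhaseSpace N × WienerPair => G (rawObs (pinnedChain ω₂ lam β γ) N i0 iN ib t a.1
      (fwdPath (pinnedChain ω₂ lam β γ) N T_L T_R a.1 a.2)) := hG.comp hobs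
  have hρG : Measurable ((fun y : Obs N => ρ y.1) * G) := hρ2.mul hG
  rw [lintegral_map hG hobs, lintegral_withDensity_eq_lintegral_mul _ hρ1 hGo,
    lintegral_withDensity_eq_lintegral_mul _ hρ2 hG, lintegral_map hρG hobs]
  rfl

/-- `fluxLaw Leb` is σ-finite: its `x_0`-marginal is Lebesgue measure. [folklore] -/
theorem sigmaFinite_fluxLaw_volume (i0 iN ib : Fin N) (t : ℝ) :
    SigmaFinite (fluxLaw (pinnedChain ω₂ lam β γ) N i0 iN ib T_L T_R t (volume : Measure (PhaseSpace N))) := by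
  refine SigmaFinite.of_map _ measurable_fst.aemeasurable ?_
  rw [fluxLaw_map_fst hω hl hβ hγ N T_L T_R volume i0 iN ib t]
  infer_instance

/-- **The heat-flux detailed balance as a flip duality of `fluxLaw Leb`.** If, for every measurable
`F ≥ 0`, `∫dz E[F(Θ̃ obs)] = ∫dz E[e^{Q_L/T_L + Q_R/T_R}(obs) F(obs)]`, then
`Θ̃_* (fluxLaw Leb) = e^{Q_L/T_L + Q_R/T_R} · fluxLaw Leb`. [folklore] -/
theorem fluxLaw_volume_map_flipObs (i0 iN ib : Fin N) (t : ℝ)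
    (hGDB : ∀ F : Obs N → ℝ≥0∞, Measurable F →
      ∫⁻ z, ∫⁻ w, F (flipObs N (rawObs (pinnedChain ω₂ lam β γ) N i0 iN ib t z
          (fwdPath (pinnedChain ω₂ lam β γ) N T_L T_R z w))) ∂wienerPair =
        ∫⁻ z, ∫⁻ w, ENNReal.ofReal (Real.exp
            (leftHeat i0 (rawObs (pinnedChain ω₂ lam β γ) N i0 iN ib t z
                (fwdPath (pinnedChain ω₂ lam β γ) N T_L T_R z w)) / T_L +
              rightHeat iN (rawObs (pinnedChain ω₂ lam β γ) N i0 iN ib t z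
                (fwdPath (pinnedChain ω₂ lam β γ) N T_L T_R z w)) / T_R)) *
          F (rawObs (pinnedChain ω₂ lam β γ) N i0 iN ib t z
            (fwdPath (pinnedChain ω₂ lam β γ) N T_L T_R z w)) ∂wienerPair) :
    (fluxLaw (pinnedChain ω₂ lam β γ) N i0 iN ib T_L T_R t (volume : Measure (PhaseSpace N))).map (flipObs N) =
      (fluxLaw (pinnedChain ω₂ lam β γ) N i0 iN ib T_L T_R t volume).withDensity
        (fun y => ENNReal.ofReal (Real.exp (leftHeat i0 y / T_L + rightHeat iN y / T_R))) := by
  have hobs := EquilibriumBondHeatVariance.measurable_rawObs_fwdPath hω hl hβ hγ N T_L T_R i0 iN ib t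
  have hE : Measurable fun y : Obs N => ENNReal.ofReal (Real.exp (leftHeat i0 y / T_L + rightHeat iN y / T_R)) := by
    unfold leftHeat rightHeat
    fun_prop
  refine Measure.ext_of_lintegral _ fun G hG => ?_
  have hGf : Measurable fun y : Obs N => G (flipObs N y) := hG.comp (measurable_flipObs N)
  have hGfo : Measurable fun a : PhaseSpace N × WienerPair => G (flipObs N (rawObs (pinnedChain ω₂ lam β γ) N
      i0 iN ib t a.1 (fwdPath (pinnedChain ω₂ lam β γ) N T_L T_R a.1 a.2))) := hGf.comp hobs
  have hEG : Measurable ((fun y : Obs N =>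
      ENNReal.ofReal (Real.exp (leftHeat i0 y / T_L + rightHeat iN y / T_R))) * G) := hE.mul hG
  have hEGo : Measurable fun a : PhaseSpace N × WienerPair => ((fun y : Obs N =>
      ENNReal.ofReal (Real.exp (leftHeat i0 y / T_L + rightHeat iN y / T_R))) * G)
        (rawObs (pinnedChain ω₂ lam β γ) N i0 iN ib t a.1 (fwdPath (pinnedChain ω₂ lam β γ) N T_L T_R a.1 a.2)) :=
    hEG.comp hobs
  rw [lintegral_map hG (measurable_flipObs N), fluxLaw_eq, lintegral_map hGf hobs,
    lintegral_withDensity_eq_lintegral_mul _ hE hG, lintegral_map hEG hobs,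
    lintegral_prod _ hGfo.aemeasurable, lintegral_prod _ hEGo.aemeasurable]
  exact hGDB G hG

end Law

/-- **K4 — the stationary entropy balance (Lebowitz–Spohn form) from the heat-flux detailed balance.**
Assuming (GDB) `∫dz E_z[F(Θ̃ obs)] = ∫dz E_z[e^{Q_L/T_L + Q_R/T_R} F(obs)]` for the pinned chain started from
Lebesgue measure: under weak-NESS uniqueness, for every weak steady state `μ` (`N ≥ 2`, `T_L, T_R > 0`) with
`KL(μ ‖ Θ_*μ) ≠ ⊤` and every `t > 0`, the endpoint–heat law `P = fluxLaw … μ` is a probability measure,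
`P ≪ Θ̃_*P ≪ P`, `llr(P, Θ̃_*P) ∈ L¹(P)`, the bath heats are integrable, and
`∫ llr(P, Θ̃_*P) dP = KL(μ ‖ Θ_*μ) - E[Q_L]/T_L - E[Q_R]/T_R`. Proof: `μ` is the kernel-invariant
Krylov–Bogoliubov state (`ness_facts`) with Lebesgue density `ρ`; `P = ρ(x_0)·R_obs`
(`fluxLaw_withDensity`), `Θ̃_*R_obs = e^W R_obs` (`fluxLaw_volume_map_flipObs`), so `flip_duality` gives
mutual absolute continuity and `llr = llr(μ,Θ_*μ)(x_0) + [f(x_0) - f(x_t)] - W`, `f = log ρ∘Θ`; the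
coboundary has mean zero by `coboundary_integral_eq_zero` (both endpoints have law `μ`), the heats are
integrable by `integrable_heats_fluxLaw`, and `∫ llr(μ,Θ_*μ) dμ = KL` (`toReal_klDiv_of_measure_eq`). -/
theorem stub_entropyBalance :
    (∀ ω₂ lam β γ : ℝ, 0 < ω₂ → 0 < lam → 0 < β → 0 < γ →
  ∀ (N : ℕ) (i0 iN ib : Fin N), 2 ≤ N → i0.val = 0 → iN.val = N - 1 →
  ∀ (T_L T_R : ℝ), 0 < T_L → 0 < T_R → ∀ t : ℝ, 0 < t →
  ∀ F : Obs N → ℝ≥0∞, Measurable F →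
    ∫⁻ z, ∫⁻ w, F (flipObs N (rawObs (pinnedChain ω₂ lam β γ) N i0 iN ib t z
        (fwdPath (pinnedChain ω₂ lam β γ) N T_L T_R z w))) ∂wienerPair =
      ∫⁻ z, ∫⁻ w, ENNReal.ofReal (Real.exp
          (leftHeat i0 (rawObs (pinnedChain ω₂ lam β γ) N i0 iN ib t z
              (fwdPath (pinnedChain ω₂ lam β γ) N T_L T_R z w)) / T_L +
            rightHeat iN (rawObs (pinnedChain ω₂ lam β γ) N i0 iN ib t z
              (fwdPath (pinnedChain ω₂ lam β γ) N T_L T_R z w)) / T_R)) *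
        F (rawObs (pinnedChain ω₂ lam β γ) N i0 iN ib t z
          (fwdPath (pinnedChain ω₂ lam β γ) N T_L T_R z w)) ∂wienerPair) →
  ∀ ω₂ lam β γ : ℝ, 0 < ω₂ → 0 < lam → 0 < β → 0 < γ →
  (∀ (N : ℕ) (T_L T_R : ℝ), 0 < T_L → 0 < T_R → ∀ μ ν : Measure (PhaseSpace N),
    (pinnedChain ω₂ lam β γ).IsSteadyState N T_L T_R μ →
    (pinnedChain ω₂ lam β γ).IsSteadyState N T_L T_R ν → μ = ν) →
  ∀ (N : ℕ) (i0 iN ib : Fin N), 2 ≤ N → i0.val = 0 → iN.val = N - 1 →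
  ∀ (T_L T_R : ℝ), 0 < T_L → 0 < T_R → ∀ μ : Measure (PhaseSpace N),
    (pinnedChain ω₂ lam β γ).IsSteadyState N T_L T_R μ →
    InformationTheory.klDiv μ (Measure.map (fun x : PhaseSpace N => (x.1, -x.2)) μ) ≠ ⊤ →
  ∀ t : ℝ, 0 < t →
    IsProbabilityMeasure (fluxLaw (pinnedChain ω₂ lam β γ) N i0 iN ib T_L T_R t μ) ∧
    fluxLaw (pinnedChain ω₂ lam β γ) N i0 iN ib T_L T_R t μ ≪
      (fluxLaw (pinnedChain ω₂ lam β γ) N i0 iN ib T_L T_R t μ).map (flipObs N) ∧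
    (fluxLaw (pinnedChain ω₂ lam β γ) N i0 iN ib T_L T_R t μ).map (flipObs N) ≪
      fluxLaw (pinnedChain ω₂ lam β γ) N i0 iN ib T_L T_R t μ ∧
    Integrable (llr (fluxLaw (pinnedChain ω₂ lam β γ) N i0 iN ib T_L T_R t μ)
      ((fluxLaw (pinnedChain ω₂ lam β γ) N i0 iN ib T_L T_R t μ).map (flipObs N)))
      (fluxLaw (pinnedChain ω₂ lam β γ) N i0 iN ib T_L T_R t μ) ∧
    Integrable (leftHeat i0) (fluxLaw (pinnedChain ω₂ lam β γ) N i0 iN ib T_L T_R t μ) ∧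
    Integrable (rightHeat iN) (fluxLaw (pinnedChain ω₂ lam β γ) N i0 iN ib T_L T_R t μ) ∧
    ∫ p, llr (fluxLaw (pinnedChain ω₂ lam β γ) N i0 iN ib T_L T_R t μ)
        ((fluxLaw (pinnedChain ω₂ lam β γ) N i0 iN ib T_L T_R t μ).map (flipObs N)) p
        ∂(fluxLaw (pinnedChain ω₂ lam β γ) N i0 iN ib T_L T_R t μ) =
      (InformationTheory.klDiv μ (Measure.map (fun x : PhaseSpace N => (x.1, -x.2)) μ)).toReal -
        (∫ p, leftHeat i0 p ∂(fluxLaw (pinnedChain ω₂ lam β γ) N i0 iN ib T_L T_R t μ)) / T_L -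
        (∫ p, rightHeat iN p ∂(fluxLaw (pinnedChain ω₂ lam β γ) N i0 iN ib T_L T_R t μ)) / T_R := by
  intro hGDB ω₂ lam β γ hω hl hβ hγ huniq N i0 iN ib hN hi0 hiN T_L T_R hL hR μ hμ hKL t ht
  classical
  /- Step 0: what (U) gives — `μ` is the kernel-invariant KB state, with density and exponential moment -/
  have hness : IsProbabilityMeasure μ ∧
      (∀ u : ℝ≥0, μ.bind ((pinnedChain ω₂ lam β γ).transitionKernel N T_L T_R u) = μ) ∧
      (∀ ϑ : ℝ, 0 < ϑ → ϑ < 1 / max T_L T_R →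
        Integrable (fun x => Real.exp (ϑ * (pinnedChain ω₂ lam β γ).hamiltonian N x)) μ) ∧
      μ ≪ (volume : Measure (PhaseSpace N)) := by
    let fam : (M : ℕ) → ℝ → ℝ → Measure (PhaseSpace M) := fun M a b =>
      if h : 0 < a ∧ 0 < b then (pinnedChain_exists_isSteadyState hω hl hβ hγ M h.1 h.2).choose else 0
    have hfam : ∀ (M : ℕ) (a b : ℝ), 0 < a → 0 < b →
        (pinnedChain ω₂ lam β γ).IsSteadyState M a b (fam M a b) := by
      intro M a b ha hb
      simp only [fam, dif_pos (And.intro ha hb)]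
      exact (pinnedChain_exists_isSteadyState hω hl hβ hγ M ha hb).choose_spec
    have hμeq : fam N T_L T_R = μ := huniq N T_L T_R hL hR _ _ (hfam N T_L T_R hL hR) hμ
    have h := ness_facts ω₂ lam β γ hω hl hβ hγ huniq fam hfam N hN T_L T_R hL hR
    rw [hμeq] at h
    exact h
  obtain ⟨hμP, hinv, hexp, hμac⟩ := hness
  have hmax : 0 < max T_L T_R := lt_max_of_lt_left hL
  have hϑ0 : 0 < 1 / max T_L T_R / 2 := by positivity
  have hϑ1 : 1 / max T_L T_R / 2 < 1 / max T_L T_R := half_lt_self (by positivity)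
  have hint := hexp _ hϑ0 hϑ1
  /- Step 1: a finite measurable version `ρ` of the Lebesgue density of `μ` -/
  set ρ : PhaseSpace N → ℝ≥0∞ := fun x => ((μ.rnDeriv volume x).toNNReal : ℝ≥0∞) with hρdef
  have hρm : Measurable ρ := (Measure.measurable_rnDeriv μ volume).ennreal_toNNReal.coe_nnreal_ennreal
  have hρt : ∀ x, ρ x ≠ ⊤ := fun x => ENNReal.coe_ne_top
  have hμρ : μ = volume.withDensity ρ := by
    have h1 : ρ =ᵐ[volume] μ.rnDeriv volume := by
      filter_upwards [Measure.rnDeriv_ne_top μ volume] with x hx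
      exact ENNReal.coe_toNNReal hx
    rw [withDensity_congr_ae h1, Measure.withDensity_rnDeriv_eq _ _ hμac]
  /- Step 2: the momentum flip `Θ`, `μ ≪ Θ_*μ`, and `llr(μ, Θ_*μ) = log ρ - log ρ∘Θ` -/
  have hΘ : (fun x : PhaseSpace N => (x.1, -x.2)) = (momentumReversal N : PhaseSpace N → PhaseSpace N) := rfl
  have hΘm : Measurable (fun x : PhaseSpace N => (x.1, -x.2)) := by
    rw [hΘ]
    exact (momentumReversal N).measurable
  have hΘΘ : Function.Involutive (fun x : PhaseSpace N => (x.1, -x.2)) := fun x => by simp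
  obtain ⟨hμΘ, hllrμ⟩ := InformationTheory.klDiv_ne_top_iff.1 hKL
  have hvolΘ : (volume : Measure (PhaseSpace N)).map (fun x : PhaseSpace N => (x.1, -x.2)) =
      (volume : Measure (PhaseSpace N)).withDensity (fun _ => 1) := by
    rw [hΘ, (measurePreserving_momentumReversal N).map_eq]
    exact (withDensity_one).symm
  have hρ0 : ∀ᵐ x ∂μ, ρ x ≠ 0 := by
    rw [hμρ]
    exact (ae_withDensity_iff hρm).2 (ae_of_all _ fun x hx => hx)
  have hρΘ : ∀ᵐ x ∂μ, ρ (x.1, -x.2) ≠ 0 := by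
    have h2 : ∀ᵐ y ∂(μ.map (fun x : PhaseSpace N => (x.1, -x.2))), ρ (y.1, -y.2) ≠ 0 := by
      refine (ae_map_iff hΘm.aemeasurable ((hρm.comp hΘm) (measurableSet_singleton 0).compl)).2 ?_
      filter_upwards [hρ0] with x hx
      simpa using hx
    exact hμΘ.ae_le h2
  have hflipμ := flip_duality (volume : Measure (PhaseSpace N)) (fun x : PhaseSpace N => (x.1, -x.2))
    (fun _ => 1) ρ hΘm hΘΘ measurable_const (fun _ => one_ne_zero) (fun _ => ENNReal.one_ne_top) hvolΘ hρm
    hρt (by rw [← hμρ]; exact hρΘ)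
  have hllrμ_ae : ∀ᵐ x ∂μ, llr μ (μ.map (fun x : PhaseSpace N => (x.1, -x.2))) x =
      Real.log (ρ x).toReal - Real.log (ρ (x.1, -x.2)).toReal := by
    have h := hflipμ.2.2.2
    rw [← hμρ] at h
    filter_upwards [h] with x hx
    rw [hx]
    simp
  have hKLint : ∫ x, llr μ (μ.map (fun x : PhaseSpace N => (x.1, -x.2))) x ∂μ =
      (InformationTheory.klDiv μ (μ.map (fun x : PhaseSpace N => (x.1, -x.2)))).toReal := by
    refine (InformationTheory.toReal_klDiv_of_measure_eq hμΘ ?_).symm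
    rw [Measure.map_apply hΘm MeasurableSet.univ, Set.preimage_univ]
  /- Step 3: the endpoint–heat law `Pf = ρ(x_0) · R`, `R = fluxLaw Leb`, and (GDB) as `Θ̃_* R = e^W R` -/
  set Pf := fluxLaw (pinnedChain ω₂ lam β γ) N i0 iN ib T_L T_R t μ with hPfdef
  set R := fluxLaw (pinnedChain ω₂ lam β γ) N i0 iN ib T_L T_R t (volume : Measure (PhaseSpace N)) with hRdef
  haveI : SigmaFinite R := sigmaFinite_fluxLaw_volume hω hl.le hβ.le hγ.le N T_L T_R i0 iN ib t
  haveI hPfP : IsProbabilityMeasure Pf := isProbabilityMeasure_fluxLaw hω hl.le hβ.le hγ.le N T_L T_R μ i0 iN ib t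
  have hPfR : Pf = R.withDensity (fun y => ρ y.1) := by
    have h := fluxLaw_withDensity hω hl.le hβ.le hγ.le N T_L T_R hρm i0 iN ib t
    rw [← hμρ] at h
    exact h
  set E : Obs N → ℝ≥0∞ := fun y => ENNReal.ofReal (Real.exp (leftHeat i0 y / T_L + rightHeat iN y / T_R))
    with hEdef
  have hEm : Measurable E := by
    rw [hEdef]
    unfold leftHeat rightHeat
    fun_prop
  have hE0 : ∀ y, E y ≠ 0 := fun y => (ENNReal.ofReal_pos.2 (Real.exp_pos _)).ne'
  have hEt : ∀ y, E y ≠ ⊤ := fun y => ENNReal.ofReal_ne_top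
  have hRflip : R.map (flipObs N) = R.withDensity E :=
    fluxLaw_volume_map_flipObs hω hl.le hβ.le hγ.le N T_L T_R i0 iN ib t
      (hGDB ω₂ lam β γ hω hl hβ hγ N i0 iN ib hN hi0 hiN T_L T_R hL hR t ht)
  have hfst : Pf.map Prod.fst = μ := fluxLaw_map_fst hω hl.le hβ.le hγ.le N T_L T_R μ i0 iN ib t
  have hend : Pf.map (fun y => y.2.1) = μ :=
    fluxLaw_map_endpoint hω hl.le hβ.le hγ.le N T_L T_R μ hinv i0 iN ib ht.le
  have hnull : ∀ᵐ y ∂Pf, ρ (y.2.1.1, -y.2.1.2) ≠ 0 := by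
    have h2 : ∀ᵐ x ∂(Pf.map fun y => y.2.1), ρ (x.1, -x.2) ≠ 0 := by
      rw [hend]
      exact hρΘ
    exact ae_of_ae_map (measurable_fst.comp measurable_snd).aemeasurable h2
  /- Step 4: flip duality on the observable space — absolute continuity and the `llr` formula -/
  have hflip := flip_duality R (flipObs N) E (fun y : Obs N => ρ y.1) (measurable_flipObs N)
    (flipObs_involutive N) hEm hE0 hEt hRflip (hρm.comp measurable_fst) (fun y => hρt _)
    (by rw [← hPfR]; exact hnull)
  rw [← hPfR] at hflip
  obtain ⟨-, hac1, hac2, hllrPf⟩ := hflip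
  /- Step 5: the heats, `W`, and the `KL` term -/
  obtain ⟨hQL, hQR⟩ := integrable_heats_fluxLaw ω₂ lam β γ hω hl.le hβ.le hγ.le N T_L T_R μ hinv _ hϑ0 hint
    i0 iN ib t ht.le
  set W : Obs N → ℝ := fun y => leftHeat i0 y / T_L + rightHeat iN y / T_R with hWdef
  have hWi : Integrable W Pf := (hQL.div_const T_L).add (hQR.div_const T_R)
  have hWint : ∫ y, W y ∂Pf = (∫ y, leftHeat i0 y ∂Pf) / T_L + (∫ y, rightHeat iN y ∂Pf) / T_R := by
    simp only [hWdef]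
    rw [integral_add (hQL.div_const T_L) (hQR.div_const T_R), integral_div, integral_div]
  set A : PhaseSpace N → ℝ := llr μ (μ.map (fun x : PhaseSpace N => (x.1, -x.2))) with hAdef
  have hAm : Measurable A := measurable_llr _ _
  have hAi : Integrable (fun y : Obs N => A y.1) Pf := by
    have h1 : Integrable A (Pf.map Prod.fst) := by
      rw [hfst]
      exact hllrμ
    exact (integrable_map_measure hAm.aestronglyMeasurable measurable_fst.aemeasurable).1 h1
  have hAint : ∫ y, A y.1 ∂Pf =
      (InformationTheory.klDiv μ (μ.map (fun x : PhaseSpace N => (x.1, -x.2)))).toReal := by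
    have h2 : ∫ x, A x ∂(Pf.map Prod.fst) = ∫ y, A y.1 ∂Pf :=
      integral_map measurable_fst.aemeasurable hAm.aestronglyMeasurable
    rw [← h2, hfst]
    exact hKLint
  /- Step 6: the decomposition `llr = A(x_0) + [f(x_0) - f(x_t)] - W`, `f = log ρ∘Θ` -/
  set f : PhaseSpace N → ℝ := fun x => Real.log (ρ (x.1, -x.2)).toReal with hfdef
  have hfm : Measurable f := (hρm.comp hΘm).ennreal_toReal.log
  have hdecomp : (llr Pf (Pf.map (flipObs N))) =ᵐ[Pf] fun y => A y.1 + (f y.1 - f y.2.1) - W y := by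
    have hA_ae : ∀ᵐ y ∂Pf, A y.1 = Real.log (ρ y.1).toReal - Real.log (ρ (y.1.1, -y.1.2)).toReal := by
      have h2 : ∀ᵐ x ∂(Pf.map Prod.fst),
          A x = Real.log (ρ x).toReal - Real.log (ρ (x.1, -x.2)).toReal := by
        rw [hfst]
        exact hllrμ_ae
      exact ae_of_ae_map measurable_fst.aemeasurable h2
    filter_upwards [hllrPf, hA_ae] with y hy hAy
    rw [hy, hAy]
    simp only [hfdef, hWdef, hEdef]
    rw [ENNReal.toReal_ofReal (Real.exp_pos _).le, Real.log_exp]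
    simp only [flipObs]
    ring
  /- Step 7: the coboundary has mean zero (no finite entropy of `ρ` needed) -/
  have hexpllr : Integrable (fun y => Real.exp (-llr Pf (Pf.map (flipObs N)) y)) Pf := by
    have h1 : (fun y => Real.exp (-llr Pf (Pf.map (flipObs N)) y)) =ᵐ[Pf]
        fun y => ((Pf.map (flipObs N)).rnDeriv Pf y).toReal := exp_neg_llr hac1
    exact (Measure.integrable_toReal_rnDeriv).congr h1.symm
  set g : Obs N → ℝ := fun y => Real.exp (-llr Pf (Pf.map (flipObs N)) y) + |A y.1| + |W y| with hgdef
  have hgi : Integrable g Pf := (hexpllr.add hAi.abs).add hWi.abs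
  have hlow : ∀ᵐ y ∂Pf, -g y ≤ f y.1 - f y.2.1 := by
    filter_upwards [hdecomp] with y hy
    have h1 : -Real.exp (-llr Pf (Pf.map (flipObs N)) y) ≤ llr Pf (Pf.map (flipObs N)) y := by
      have := Real.add_one_le_exp (-llr Pf (Pf.map (flipObs N)) y)
      linarith
    have h2 := neg_abs_le (A y.1)
    have h3 := le_abs_self (A y.1)
    have h4 := neg_abs_le (W y)
    have h5 := le_abs_self (W y)
    simp only [hgdef]
    linarith
  obtain ⟨hDi, hD0⟩ := coboundary_integral_eq_zero Pf Prod.fst (fun y : Obs N => y.2.1) f g measurable_fst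
    (measurable_fst.comp measurable_snd) hfm (hfst.trans hend.symm) hgi hlow
  /- Step 8: conclusion -/
  have hAD : Integrable (fun y => A y.1 + (f y.1 - f y.2.1)) Pf := hAi.add hDi
  have hsum : Integrable (fun y => A y.1 + (f y.1 - f y.2.1) - W y) Pf := hAD.sub hWi
  have hllri : Integrable (llr Pf (Pf.map (flipObs N))) Pf := hsum.congr hdecomp.symm
  have hllrint : ∫ y, llr Pf (Pf.map (flipObs N)) y ∂Pf =
      (InformationTheory.klDiv μ (μ.map (fun x : PhaseSpace N => (x.1, -x.2)))).toReal -
        (∫ y, leftHeat i0 y ∂Pf) / T_L - (∫ y, rightHeat iN y ∂Pf) / T_R := by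
    rw [integral_congr_ae hdecomp, integral_sub hAD hWi, integral_add hAi hDi, hD0, hAint, hWint]
    ring
  exact ⟨hPfP, hac1, hac2, hllri, hQL, hQR, hllrint⟩

end Summit.AtomisticToContinuum.FouriersLaw.Theorems.LinearResponseFTUR

end
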